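import Literature.Geometry.Kaehler.ChernWeilTransgression
import Literature.Geometry.Kaehler.MatrixFormWords
import HarnessLib

/-!
# Chern–Weil II, polynomial part: `Ω_t = Ω₀ + tA + t²B` along the line of connections

Layer `Literature/Geometry/Kaehler`. Second file towards the discharge of
`SmoothComplexVectorBundle.mk_eq_mk_of_isChernCharacterForm` (`ChernCharacter.lean`, "Chern–Weil
II"), after `ChernWeilTransgression` (the line of connections `D_t`, (I.1.7), and
`d tr(α ∧ Ωᵖ) = tr(Dα ∧ Ωᵖ)`) and `MatrixFormWords` (expansion of `(X₀ + tX₁ + t²X₂)ᵖ` into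
words). Kobayashi, *Differential Geometry of Complex Vector Bundles* (1987), Ch. II §2, p. 34:
"(2.6) `ω_t = ω₀ + tα` […] (2.7) `Ω_t = dω_t + ω_t ∧ ω_t` so that (2.8)
`dΩ_t/dt = dα + α ∧ ω_t + ω_t ∧ α = D_t α`". Here, with `α = ω₁ − ω₀` and the LETTERS
`X₀ = Ω₀`, `X₁ = A = dα + α ∧ ω₀ + ω₀ ∧ α`, `X₂ = B = α ∧ α` of the frame `s_i`
(`Connection.letters`), everything PROVED pointwise at the points of `U_i`:

* `Connection.curvature_line_apply` — **(2.7) made explicit**: `Ω_t(x) = (Ω₀ + tA + t²B)(x)`;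
  hence `Ω_tᵖ(x)` is the value of `Σ_e t^{wt e} word X p e` (`npow_curvature_line_eq_sum_apply`);
* `Connection.covDeriv_line_eq` — **(2.8)**: `dα + α ∧ ω_t + ω_t ∧ α = A + 2tB`;
* `Connection.mextDeriv_trace_npow_wedge_apply` — the key identity of `ChernWeilTransgression` in
  the degree-friendly order `d tr(Ω_tᵖ ∧ α)(x) = tr((A + 2tB) ∧ Ω_tᵖ)(x)` (cast to `2p + 1 + 1`);
* `Connection.sum_pow_smul_mextDeriv_trace_word_wedge_apply` — **the expanded identity**: with the
  local forms `τ_e = tr(word X p e ∧ α)` one has, for every real `t` and `x ∈ U_i`,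
  `Σ_e t^{wt e} (dτ_e)(x) = Σ_{c, e'} c t^{c−1+wt e'} tr(word X (p+1) (cons c e'))(x)`
  — the two sides of `d k f(α, Ω_t, …) = (d/dt) f(Ω_t, …, Ω_t)` written out in powers of `t`;
* smoothness at the points of `U_i` of the letters, the words and the `τ_e`.

## References

* S. Kobayashi, *Differential Geometry of Complex Vector Bundles* (1987), Ch. II §2 (2.6)–(2.10).
-/

noncomputable section

open scoped Manifold ContDiff Topology Matrix
open Set Filter

namespace Literature.Geometry.Kaehler

namespace MatrixForm

variable {E : Type*} [NormedAddCommGroup E] [NormedSpace ℝ E]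
  {H : Type*} [TopologicalSpace H] {I : ModelWithCorners ℝ E H}
  {M : Type*} [TopologicalSpace M] [ChartedSpace H M] {r k : ℕ}

/-- `d` commutes with real scalars on matrices of forms (no smoothness needed). [folklore] -/
theorem d_smul (c : ℝ) (A : MatrixForm I M r k) : (c • A).d = c • A.d := by
  ext a b x : 2
  rw [d_apply, Matrix.smul_apply, mextDeriv_smul, Matrix.smul_apply, d_apply]

/-- The values at `x` of the wedge powers of a matrix of `2`-forms only depend on its values at
`x`. [folklore] -/
theorem npow_apply_congr {Ω Ω' : MatrixForm I M r 2} {x : M} (h : ∀ a b, Ω a b x = Ω' a b x) :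
    ∀ (p : ℕ) (a b : Fin r), npow Ω p a b x = npow Ω' p a b x
  | 0, _, _ => rfl
  | p + 1, a, b => by
    rw [npow_succ, npow_succ, castDeg_apply, castDeg_apply]
    exact MForm.castDeg_apply_eq _ (wedge_apply_congr (fun c ↦ npow_apply_congr h p a c) (fun c ↦ h c b))

/-- The entries of the words in letters smooth at `x` are smooth at `x`. [folklore] -/
theorem smoothAt_word {X : Fin 3 → MatrixForm I M r 2} {x : M} (hX : ∀ c a b, (X c a b).SmoothAt x) :
    ∀ (m : ℕ) (e : Fin m → Fin 3) (a b : Fin r), (word X m e a b).SmoothAt x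
  | 0, _, a, b => by
    rw [word_zero, one, Matrix.diagonal_apply]
    split_ifs
    · exact MForm.smoothAt_ofFun_of_contMDiffAt contMDiffAt_const
    · exact MForm.smoothAt_zero x
  | m + 1, e, a, b => by
    rw [word_succ]
    exact smoothAt_castDeg _ (smoothAt_wedge (smoothAt_word hX m (Fin.init e)) (hX _)) a b

/-- A word with a prescribed first letter, as a cast of a cons word:
`X_c ∧ word m e = word (m+1) (cons c e)` up to the cast. [folklore] -/
theorem wedge_word_eq_word_cons (X : Fin 3 → MatrixForm I M r 2) (m : ℕ) (c : Fin 3) (e : Fin m → Fin 3) :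
    (X c).wedge (word X m e) = (word X (m + 1) (Fin.cons c e)).castDeg (by omega) := by
  rw [word_succ_eq_cons, Fin.cons_zero, Fin.tail_cons, castDeg_castDeg, castDeg_rfl]

end MatrixForm

namespace SmoothComplexVectorBundle

namespace Connection

variable {ι : Type*} {E : Type*} [NormedAddCommGroup E] [NormedSpace ℂ E]
  {M : Type*} [TopologicalSpace M] [ChartedSpace E M] {r : ℕ}
  {V : SmoothComplexVectorBundle ι E M r}

/-- **The letters of the transgression** in the frame `s_i`: `X₀ = Ω₀` (curvature of `D₀`),
`X₁ = A = dα + α ∧ ω₀ + ω₀ ∧ α` and `X₂ = B = α ∧ α`, where `α = ω₁ − ω₀`, so that along the line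
of connections `ω_t = ω₀ + tα` the curvature is `Ω_t = X₀ + tX₁ + t²X₂` (Kobayashi (2.6)–(2.7)).
[cite: Kobayashi1987, Ch. II §2 (2.7)] -/
def letters (D₀ D₁ : V.Connection) (i : ι) : Fin 3 → MatrixForm 𝓘(ℝ, E) M r 2 :=
  ![D₀.curvature i,
    (D₁.form i - D₀.form i).d + (D₁.form i - D₀.form i).wedge (D₀.form i) +
      (D₀.form i).wedge (D₁.form i - D₀.form i),
    (D₁.form i - D₀.form i).wedge (D₁.form i - D₀.form i)]

/-- `X₀ = Ω₀`. [cite: Kobayashi1987, Ch. II §2 (2.7)] -/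
@[simp]
theorem letters_zero (D₀ D₁ : V.Connection) (i : ι) : letters D₀ D₁ i 0 = D₀.curvature i := rfl

/-- `X₁ = dα + α ∧ ω₀ + ω₀ ∧ α`. [cite: Kobayashi1987, Ch. II §2 (2.8)] -/
@[simp]
theorem letters_one (D₀ D₁ : V.Connection) (i : ι) :
    letters D₀ D₁ i 1 = (D₁.form i - D₀.form i).d + (D₁.form i - D₀.form i).wedge (D₀.form i) +
      (D₀.form i).wedge (D₁.form i - D₀.form i) := rfl

/-- `X₂ = α ∧ α`. [cite: Kobayashi1987, Ch. II §2 (2.7)] -/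
@[simp]
theorem letters_two (D₀ D₁ : V.Connection) (i : ι) :
    letters D₀ D₁ i 2 = (D₁.form i - D₀.form i).wedge (D₁.form i - D₀.form i) := rfl

/-- The polynomial `Σ_c tᶜ X_c = Ω₀ + tA + t²B`. [cite: Kobayashi1987, Ch. II §2 (2.7)] -/
theorem sum_pow_smul_letters (D₀ D₁ : V.Connection) (i : ι) (t : ℝ) :
    ∑ c : Fin 3, (t ^ (c : ℕ)) • letters D₀ D₁ i c =
      D₀.curvature i + t • letters D₀ D₁ i 1 + (t ^ 2) • letters D₀ D₁ i 2 := by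
  rw [Fin.sum_univ_three]
  simp only [letters_zero, Fin.val_zero, pow_zero, one_smul, Fin.val_one, pow_one, Fin.val_two]

/-- **Kobayashi (2.8): `dα + α ∧ ω_t + ω_t ∧ α = A + 2tB`** along `ω_t = ω₀ + tα`.
[cite: Kobayashi1987, Ch. II §2 (2.8)] -/
theorem covDeriv_line_eq (D₀ D₁ : V.Connection) (i : ι) (t : ℝ) :
    (D₁.form i - D₀.form i).d + (D₁.form i - D₀.form i).wedge ((line D₀ D₁ t).form i) +
        ((line D₀ D₁ t).form i).wedge (D₁.form i - D₀.form i) =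
      letters D₀ D₁ i 1 + (2 * t) • letters D₀ D₁ i 2 := by
  rw [line_form, letters_one, letters_two, MatrixForm.wedge_add, MatrixForm.add_wedge,
    MatrixForm.wedge_smul, MatrixForm.smul_wedge, mul_smul, two_smul]
  abel

/-- **Kobayashi (2.7) made explicit: `Ω_t(x) = (Ω₀ + tA + t²B)(x)`** at the points of `U_i`
(`Ω_t = d(ω₀ + tα) + (ω₀ + tα) ∧ (ω₀ + tα)`, `d` being additive at points of smoothness).
[cite: Kobayashi1987, Ch. II §2 (2.7)] -/
theorem curvature_line_apply (D₀ D₁ : V.Connection) {i : ι} {x : M} (hi : x ∈ V.baseSet i) (t : ℝ)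
    (a b : Fin r) :
    (line D₀ D₁ t).curvature i a b x = (∑ c : Fin 3, (t ^ (c : ℕ)) • letters D₀ D₁ i c) a b x := by
  have h0 := D₀.smoothAt_form hi
  have h1 := D₁.smoothAt_form hi
  have hα : ∀ c d, ((D₁.form i - D₀.form i) c d).SmoothAt x := fun c d ↦ (h1 c d).sub (h0 c d)
  have htα : ∀ c d, ((t • (D₁.form i - D₀.form i)) c d).SmoothAt x := fun c d ↦ (hα c d).smul t
  rw [sum_pow_smul_letters, curvature, curvature, line_form, Matrix.add_apply, Pi.add_apply,
    MatrixForm.d_add_apply h0 htα, MatrixForm.d_smul, letters_one, letters_two,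
    MatrixForm.add_wedge, MatrixForm.wedge_add, MatrixForm.wedge_add, MatrixForm.wedge_smul,
    MatrixForm.smul_wedge, MatrixForm.smul_wedge, MatrixForm.wedge_smul, smul_smul, ← pow_two]
  simp only [Matrix.add_apply, Pi.add_apply, Matrix.smul_apply, Pi.smul_apply, smul_add]
  abel

/-- Hence the wedge powers: `Ω_tᵖ(x) = (Σ_e t^{wt e} word X p e)(x)` at the points of `U_i`
(`npow` is pointwise; expansion `MatrixForm.npow_sum_pow_smul`). [cite: Kobayashi1987, Ch. II §2 (2.7)] -/
theorem npow_curvature_line_eq_sum_apply (D₀ D₁ : V.Connection) {i : ι} {x : M} (hi : x ∈ V.baseSet i)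
    (t : ℝ) (p : ℕ) (a b : Fin r) :
    MatrixForm.npow ((line D₀ D₁ t).curvature i) p a b x =
      (∑ e : Fin p → Fin 3, (t ^ MatrixForm.wordWt e) • MatrixForm.word (letters D₀ D₁ i) p e) a b x := by
  rw [MatrixForm.npow_apply_congr (fun a b ↦ curvature_line_apply D₀ D₁ hi t a b) p a b,
    MatrixForm.npow_sum_pow_smul]

variable [IsManifold 𝓘(ℝ, E) ∞ M]

/-- The letters have entries smooth at the points of `U_i`. [cite: Kobayashi1987, Ch. II §2 (2.7)] -/
theorem smoothAt_letters (D₀ D₁ : V.Connection) {i : ι} {x : M} (hi : x ∈ V.baseSet i) :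
    ∀ (c : Fin 3) (a b : Fin r), (letters D₀ D₁ i c a b).SmoothAt x := by
  have h0 := D₀.smoothAt_form hi
  have h1 := D₁.smoothAt_form hi
  have hα : ∀ c d, ((D₁.form i - D₀.form i) c d).SmoothAt x := fun c d ↦ (h1 c d).sub (h0 c d)
  have hdα : ∀ c d, ((D₁.form i - D₀.form i).d c d).SmoothAt x := fun c d ↦ by
    rw [MatrixForm.d_apply, Matrix.sub_apply]
    refine MForm.SmoothAt.mextDeriv ?_
    filter_upwards [D₁.eventually_smoothAt_form hi c d, D₀.eventually_smoothAt_form hi c d] with y hy₁ hy₀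
    exact hy₁.sub hy₀
  intro c a b
  fin_cases c
  · exact D₀.smoothAt_curvature hi a b
  · change MForm.SmoothAt ((letters D₀ D₁ i 1) a b) x
    rw [letters_one, Matrix.add_apply, Matrix.add_apply]
    exact ((hdα a b).add (MatrixForm.smoothAt_wedge hα h0 a b)).add (MatrixForm.smoothAt_wedge h0 hα a b)
  · change MForm.SmoothAt ((letters D₀ D₁ i 2) a b) x
    rw [letters_two]
    exact MatrixForm.smoothAt_wedge hα hα a b

/-- The local transgression integrands `τ_e = tr(word X p e ∧ α)` are smooth at the points of
`U_i`. [cite: Kobayashi1987, Ch. II §2 (2.9)] -/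
theorem smoothAt_trace_word_wedge (D₀ D₁ : V.Connection) {i : ι} {x : M} (hi : x ∈ V.baseSet i)
    (p : ℕ) (e : Fin p → Fin 3) :
    MForm.SmoothAt ((MatrixForm.word (letters D₀ D₁ i) p e).wedge (D₁.form i - D₀.form i)).trace x := by
  have hα : ∀ c d, ((D₁.form i - D₀.form i) c d).SmoothAt x := fun c d ↦
    (D₁.smoothAt_form hi c d).sub (D₀.smoothAt_form hi c d)
  simp only [Matrix.trace, Matrix.diag_apply]
  exact MForm.smoothAt_sum _ fun a _ ↦ MatrixForm.smoothAt_wedge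
    (MatrixForm.smoothAt_word (smoothAt_letters D₀ D₁ hi) p e) hα a a

/-! ### The key identity in powers of `t` -/

/-- **`d tr(Ω_tᵖ ∧ α)(x) = tr((A + 2tB) ∧ Ω_tᵖ)(x)`** at the points of `U_i` (the right-hand side
cast along `1 + 1 + 2p = 2p + 1 + 1`): the key identity
`mextDeriv_trace_wedge_npow_curvature_apply` for the connection `D_t` in the degree-friendly order
(`tr(Ωᵖ ∧ α) = tr(α ∧ Ωᵖ)`, graded cyclicity) together with (2.8) `covDeriv_line_eq`.
[cite: Kobayashi1987, Ch. II §2 (2.8)–(2.10)] -/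
theorem mextDeriv_trace_npow_wedge_apply (D₀ D₁ : V.Connection) {i : ι} {x : M} (hi : x ∈ V.baseSet i)
    (t : ℝ) (p : ℕ) :
    mextDeriv ((MatrixForm.npow ((line D₀ D₁ t).curvature i) p).wedge (D₁.form i - D₀.form i)).trace x =
      ((((letters D₀ D₁ i 1 + (2 * t) • letters D₀ D₁ i 2).wedge
          (MatrixForm.npow ((line D₀ D₁ t).curvature i) p)).castDeg
            (by omega : 1 + 1 + 2 * p = 2 * p + 1 + 1)).trace) x := by
  set α := D₁.form i - D₀.form i with hαdef
  set X := MatrixForm.npow ((line D₀ D₁ t).curvature i) p with hXdef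
  have hα : ∀ a b, ∀ᶠ y in 𝓝 x, (α a b).SmoothAt y := fun a b ↦ by
    filter_upwards [D₁.eventually_smoothAt_form hi a b, D₀.eventually_smoothAt_form hi a b] with y h₁ h₀
    exact h₁.sub h₀
  have hsign : ((-1 : ℝ) ^ (1 * (2 * p))) = 1 := by rw [one_mul, pow_mul, neg_one_sq, one_pow]
  have hcomm : (X.wedge α).trace = ((α.wedge X).trace).castDeg (Nat.add_comm 1 (2 * p)) := by
    rw [MatrixForm.trace_wedge_comm α X, hsign, one_smul]
  rw [hcomm, Literature.NumberTheory.Transcendental.mextDeriv_castDeg,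
    MForm.castDeg_apply_eq _ ((line D₀ D₁ t).mextDeriv_trace_wedge_npow_curvature_apply hi hα p),
    covDeriv_line_eq, MatrixForm.trace_castDeg, MForm.castDeg_castDeg, MatrixForm.trace_castDeg]

/-- **The key identity written out in powers of `t`.** With `τ_e = tr(word X p e ∧ α)` (the
coefficients of `tr(Ω_tᵖ ∧ α)`, by the expansion of `Ω_tᵖ`), for every real `t` and `x ∈ U_i`:
`Σ_e t^{wt e} (dτ_e)(x) = Σ_c Σ_{e'} (c t^{c−1} t^{wt e'}) tr(word X (p+1) (cons c e'))(x)`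
(`d` through the finite sum at a point of smoothness, locality of `d`, the identity
`mextDeriv_trace_npow_wedge_apply`, the expansions of `Ω_tᵖ` and of `A + 2tB = Σ_c c t^{c−1} X_c`,
and `X_c ∧ word e' = word (cons c e')`). [cite: Kobayashi1987, Ch. II §2 (2.8)–(2.10)] -/
theorem sum_pow_smul_mextDeriv_trace_word_wedge_apply (D₀ D₁ : V.Connection) {i : ι} {x : M}
    (hi : x ∈ V.baseSet i) (t : ℝ) (p : ℕ) :
    ∑ e : Fin p → Fin 3, (t ^ MatrixForm.wordWt e) •
        mextDeriv ((MatrixForm.word (letters D₀ D₁ i) p e).wedge (D₁.form i - D₀.form i)).trace x =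
      ∑ c : Fin 3, ∑ e' : Fin p → Fin 3, (((c : ℕ) : ℝ) * t ^ ((c : ℕ) - 1) * t ^ MatrixForm.wordWt e') •
        ((MatrixForm.word (letters D₀ D₁ i) (p + 1) (Fin.cons c e')).trace : MForm 𝓘(ℝ, E) M ℂ _) x := by
  set α := D₁.form i - D₀.form i with hαdef
  set X := letters D₀ D₁ i with hXdef
  -- (1) left-hand side = `d` of the expanded form = `d tr(Ω_tᵖ ∧ α)` at `x`
  have hsm : ∀ e : Fin p → Fin 3, MForm.SmoothAt
      ((t ^ MatrixForm.wordWt e) • ((MatrixForm.word X p e).wedge α).trace) x := fun e ↦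
    (smoothAt_trace_word_wedge D₀ D₁ hi p e).smul _
  have hexp : ∀ y ∈ V.baseSet i, ((MatrixForm.npow ((line D₀ D₁ t).curvature i) p).wedge α).trace y =
      (∑ e : Fin p → Fin 3, (t ^ MatrixForm.wordWt e) • ((MatrixForm.word X p e).wedge α).trace) y := by
    intro y hy
    have h1 : ((MatrixForm.npow ((line D₀ D₁ t).curvature i) p).wedge α).trace y =
        ((∑ e : Fin p → Fin 3, (t ^ MatrixForm.wordWt e) • MatrixForm.word X p e).wedge α).trace y := by
      simp only [Matrix.trace, Matrix.diag_apply, Finset.sum_apply]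
      exact Finset.sum_congr rfl fun a _ ↦ MatrixForm.wedge_apply_congr
        (fun c ↦ npow_curvature_line_eq_sum_apply D₀ D₁ hy t p a c) (fun _ ↦ rfl)
    rw [h1, MatrixForm.sum_wedge, MatrixForm.trace_sum, Finset.sum_apply, Finset.sum_apply]
    exact Finset.sum_congr rfl fun e _ ↦ by rw [MatrixForm.smul_wedge, MatrixForm.trace_smul]
  have hL : ∑ e : Fin p → Fin 3, (t ^ MatrixForm.wordWt e) •
      mextDeriv ((MatrixForm.word X p e).wedge α).trace x =
        mextDeriv ((MatrixForm.npow ((line D₀ D₁ t).curvature i) p).wedge α).trace x := by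
    rw [mextDeriv_congr_of_eventuallyEq (eventually_of_mem ((V.isOpen_baseSet i).mem_nhds hi) hexp),
      mextDeriv_sum_apply_of_smoothAt _ fun e _ ↦ hsm e]
    exact Finset.sum_congr rfl fun e _ ↦ by rw [mextDeriv_smul, Pi.smul_apply]
  -- (2) right-hand side of the key identity, expanded
  have hA : X 1 + (2 * t) • X 2 = ∑ c : Fin 3, (((c : ℕ) : ℝ) * t ^ ((c : ℕ) - 1)) • X c := by
    rw [Fin.sum_univ_three]
    simp only [Fin.val_zero, Fin.val_one, Fin.val_two]
    norm_num
  rw [hL, mextDeriv_trace_npow_wedge_apply D₀ D₁ hi t p, ← hXdef]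
  set P := ∑ e : Fin p → Fin 3, (t ^ MatrixForm.wordWt e) • MatrixForm.word X p e with hPdef
  have ha : ((((X 1 + (2 * t) • X 2).wedge (MatrixForm.npow ((line D₀ D₁ t).curvature i) p)).castDeg
        (by omega : 1 + 1 + 2 * p = 2 * p + 1 + 1)).trace) x =
      ((((X 1 + (2 * t) • X 2).wedge P).castDeg (by omega : 1 + 1 + 2 * p = 2 * p + 1 + 1)).trace) x := by
    simp only [Matrix.trace, Matrix.diag_apply, Finset.sum_apply, MatrixForm.castDeg_apply]
    exact Finset.sum_congr rfl fun a _ ↦ MForm.castDeg_apply_eq _ (MatrixForm.wedge_apply_congr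
      (fun _ ↦ rfl) (fun c ↦ npow_curvature_line_eq_sum_apply D₀ D₁ hi t p c a))
  have hb : ((X 1 + (2 * t) • X 2).wedge P).castDeg (by omega : 1 + 1 + 2 * p = 2 * p + 1 + 1) =
      ∑ c : Fin 3, ∑ e : Fin p → Fin 3, (((c : ℕ) : ℝ) * t ^ ((c : ℕ) - 1) * t ^ MatrixForm.wordWt e) •
        (MatrixForm.word X (p + 1) (Fin.cons c e)).castDeg (by omega : 2 * (p + 1) = 2 * p + 1 + 1) := by
    rw [hA, MatrixForm.sum_wedge, MatrixForm.castDeg_sum]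
    refine Finset.sum_congr rfl fun c _ ↦ ?_
    rw [hPdef, MatrixForm.wedge_sum, MatrixForm.castDeg_sum]
    refine Finset.sum_congr rfl fun e _ ↦ ?_
    rw [MatrixForm.smul_wedge, MatrixForm.wedge_smul, smul_smul, MatrixForm.wedge_word_eq_word_cons,
      MatrixForm.castDeg_smul, MatrixForm.castDeg_castDeg]
  rw [ha, hb, MatrixForm.trace_sum, Finset.sum_apply]
  refine Finset.sum_congr rfl fun c _ ↦ ?_
  rw [MatrixForm.trace_sum, Finset.sum_apply]
  refine Finset.sum_congr rfl fun e _ ↦ ?_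
  rw [MatrixForm.trace_smul, Pi.smul_apply, MatrixForm.trace_castDeg, MForm.castDeg_eq_self]

end Connection

end SmoothComplexVectorBundle

end Literature.Geometry.Kaehler

end
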